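import Summits.KontsevichZagierPeriods.Zeta5Search.Certificates.RecordRayLineProfile
import Summits.KontsevichZagierPeriods.Zeta5Search.Certificates.RayH1LineStep
import Summits.KontsevichZagierPeriods.Zeta5Search.Certificates.RayH1DualNumerics
import HarnessLib

/-!
# ζ(5) search — certificates: the modulus profile of `R_b` on a horizontal line, ray RayH1 — the monotone step
(cell `pub-zeta5`, P1 g11; port of the ray-specific half of certifier 2's `Certificates/RecordRayLineProfile.lean`)

HONEST FRAMING: systematic search; no irrationality claim unless certified.

OUR work (Summit side). The generic half of `RecordRayLineProfile` (`Rc = 2(t+h)·P(t)/∏_j W_j(t)`, `|·|²` on the line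
`t = x + iY` as the products `Nm/Dx`, block telescoping `Nm_step`/`Dx_step`) is imported by name. Here, for
`b = natB (34n) (BH1E e n)` (`e = 0`: the ray RayH1, `e = 1`: its partner):
* `stepNumH1_eq`, `stepDenH1_eq` — the certificate polynomials of `RayH1LineStep` in the variable `x`;
* **`normSq_Rc_step_le_H1`** — if `stepDenH1 ≤ stepNumH1` at the offset `a = −x − h − 1/2` then
  `|R_b(x+iY)|² ≤ |R_b(x+1+iY)|²` (one step towards the centre does not decrease the modulus).
-/

noncomputable section

open Finset Complex

namespace Summit.KontsevichZagierPeriods.Zeta5Search.RayH1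

open Summit.KontsevichZagierPeriods.Zeta5Search.DualSeriesBounds (natB)
open Summit.KontsevichZagierPeriods.Zeta5Search.DualPF (Rc)
open Summit.KontsevichZagierPeriods.Zeta5Search.RecordLine (qsq Dx Nm Dx_pos Nm_pos normSq_Rc_mul Nm_step Dx_step)

section Step

variable (e n : ℕ) (Y : ℝ)

/-- The certificate's numerator in the variable `x` (`a = −x − h − 1/2`, `h = (34n+2)/2`):
`stepNumH1 = q(x+1+h)·q(x+2+34n)·∏_j q(x+1+B_j)`. -/
theorem stepNumH1_eq (x : ℝ) :
    stepNumH1 e n Y (-x - ((34 * n : ℕ) + 2 : ℝ) / 2 - 1 / 2) =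
      qsq Y (x + 1 + (((34 * n : ℕ) : ℝ) + 2) / 2) * qsq Y (x + 1 + ((34 * n + 1 : ℕ) : ℝ)) *
        ∏ j ∈ range 7, qsq Y (x + 1 + (BH1E e n j : ℝ)) := by
  set a : ℝ := -x - ((34 * n : ℕ) + 2 : ℝ) / 2 - 1 / 2 with ha
  unfold stepNumH1
  have f0 : qsq Y (a - 1 / 2) = qsq Y (x + 1 + (((34 * n : ℕ) : ℝ) + 2) / 2) := by
    rw [ha]; unfold qsq; push_cast; ring
  have f1 : qsq Y (34 / 2 * (n : ℝ) + 1 / 2 - a) = qsq Y (x + 1 + ((34 * n + 1 : ℕ) : ℝ)) := by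
    rw [ha]; unfold qsq; push_cast; ring
  have g0 : qsq Y (3 * (n : ℝ) + 1 / 2 + a) = qsq Y (x + 1 + (BH1E e n 0 : ℝ)) := by
    rw [ha, BH1E_val0]; unfold qsq; push_cast; ring
  have g1 : qsq Y (4 * (n : ℝ) + 1 / 2 + a) = qsq Y (x + 1 + (BH1E e n 1 : ℝ)) := by
    rw [ha, BH1E_val1]; unfold qsq; push_cast; ring
  have g2 : qsq Y (5 * (n : ℝ) + 1 / 2 + a) = qsq Y (x + 1 + (BH1E e n 2 : ℝ)) := by
    rw [ha, BH1E_val2]; unfold qsq; push_cast; ring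
  have g3 : qsq Y (6 * (n : ℝ) + 1 / 2 + a) = qsq Y (x + 1 + (BH1E e n 3 : ℝ)) := by
    rw [ha, BH1E_val3]; unfold qsq; push_cast; ring
  have g4 : qsq Y (7 * (n : ℝ) + 1 / 2 + a) = qsq Y (x + 1 + (BH1E e n 4 : ℝ)) := by
    rw [ha, BH1E_val4]; unfold qsq; push_cast; ring
  have g5 : qsq Y (8 * (n : ℝ) + 1 / 2 + a) = qsq Y (x + 1 + (BH1E e n 5 : ℝ)) := by
    rw [ha, BH1E_val5]; unfold qsq; push_cast; ring
  have g6 : qsq Y (9 * (n : ℝ) + 1 / 2 - (e : ℝ) + a) = qsq Y (x + 1 + (BH1E e n 6 : ℝ)) := by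
    rw [ha, BH1E_val6]; unfold qsq; push_cast; ring
  rw [f0, f1, g0, g1, g2, g3, g4, g5, g6]
  simp only [prod_range_succ, prod_range_zero, one_mul]

/-- The certificate's denominator in the variable `x`: `stepDenH1 = q(x+h)·q(x+1)·∏_j q(x+2+34n−B_j)` (`e ≤ 1`, `n ≥ 1`). -/
theorem stepDenH1_eq (x : ℝ) (he : e ≤ 1) (hn : 1 ≤ n) :
    stepDenH1 e n Y (-x - ((34 * n : ℕ) + 2 : ℝ) / 2 - 1 / 2) =
      qsq Y (x + (((34 * n : ℕ) : ℝ) + 2) / 2) * qsq Y (x + 1) *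
        ∏ j ∈ range 7, qsq Y (x + 1 + ((34 * n + 1 - BH1E e n j : ℕ) : ℝ)) := by
  set a : ℝ := -x - ((34 * n : ℕ) + 2 : ℝ) / 2 - 1 / 2 with ha
  unfold stepDenH1
  have f0 : qsq Y (a + 1 / 2) = qsq Y (x + (((34 * n : ℕ) : ℝ) + 2) / 2) := by
    rw [ha]; unfold qsq; push_cast; ring
  have f1 : qsq Y (34 / 2 * (n : ℝ) + 1 / 2 + a) = qsq Y (x + 1) := by
    rw [ha]; unfold qsq; push_cast; ring
  have g0 : qsq Y (3 * (n : ℝ) + 1 / 2 - a) = qsq Y (x + 1 + ((34 * n + 1 - BH1E e n 0 : ℕ) : ℝ)) := by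
    rw [ha, BH1E_val0, Nat.cast_sub (by omega)]; unfold qsq; push_cast; ring
  have g1 : qsq Y (4 * (n : ℝ) + 1 / 2 - a) = qsq Y (x + 1 + ((34 * n + 1 - BH1E e n 1 : ℕ) : ℝ)) := by
    rw [ha, BH1E_val1, Nat.cast_sub (by omega)]; unfold qsq; push_cast; ring
  have g2 : qsq Y (5 * (n : ℝ) + 1 / 2 - a) = qsq Y (x + 1 + ((34 * n + 1 - BH1E e n 2 : ℕ) : ℝ)) := by
    rw [ha, BH1E_val2, Nat.cast_sub (by omega)]; unfold qsq; push_cast; ring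
  have g3 : qsq Y (6 * (n : ℝ) + 1 / 2 - a) = qsq Y (x + 1 + ((34 * n + 1 - BH1E e n 3 : ℕ) : ℝ)) := by
    rw [ha, BH1E_val3, Nat.cast_sub (by omega)]; unfold qsq; push_cast; ring
  have g4 : qsq Y (7 * (n : ℝ) + 1 / 2 - a) = qsq Y (x + 1 + ((34 * n + 1 - BH1E e n 4 : ℕ) : ℝ)) := by
    rw [ha, BH1E_val4, Nat.cast_sub (by omega)]; unfold qsq; push_cast; ring
  have g5 : qsq Y (8 * (n : ℝ) + 1 / 2 - a) = qsq Y (x + 1 + ((34 * n + 1 - BH1E e n 5 : ℕ) : ℝ)) := by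
    rw [ha, BH1E_val5, Nat.cast_sub (by omega)]; unfold qsq; push_cast; ring
  have g6 : qsq Y (9 * (n : ℝ) + 1 / 2 - (e : ℝ) - a) = qsq Y (x + 1 + ((34 * n + 1 - BH1E e n 6 : ℕ) : ℝ)) := by
    rw [ha, BH1E_val6, Nat.cast_sub (by omega)]; unfold qsq; push_cast; ring
  rw [f0, f1, g0, g1, g2, g3, g4, g5, g6]
  simp only [prod_range_succ, prod_range_zero, one_mul]

end Step

/-- **THE MONOTONE STEP.** If the certificate `stepDenH1 ≤ stepNumH1` holds at the offset `a = −x−h−1/2`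
(`Certificates/RayH1LineStep*`), then `|R_b(x+iY)|² ≤ |R_b(x+1+iY)|²` for `b = natB (34n) (BH1E e n)`, `e ≤ 1`, `n ≥ 1`. -/
theorem normSq_Rc_step_le_H1 {e n : ℕ} (he : e ≤ 1) (hn : 1 ≤ n) {Y : ℝ} (hY : 0 < Y) (x : ℝ)
    (hcert : stepDenH1 e n Y (-x - ((34 * n : ℕ) + 2 : ℝ) / 2 - 1 / 2) ≤
      stepNumH1 e n Y (-x - ((34 * n : ℕ) + 2 : ℝ) / 2 - 1 / 2)) :
    ‖Rc (natB (34 * n) (BH1E e n)) ((x : ℂ) + Y * I)‖ ^ 2 ≤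
      ‖Rc (natB (34 * n) (BH1E e n)) (((x + 1 : ℝ) : ℂ) + Y * I)‖ ^ 2 := by
  set B₀ := 34 * n with hB₀
  have hreg := hreg_h1E he hn
  have h0 := normSq_Rc_mul B₀ (BH1E e n) hreg (x := x) hY.ne'
  have h1 := normSq_Rc_mul B₀ (BH1E e n) hreg (x := x + 1) hY.ne'
  have hD0 := Dx_pos B₀ (BH1E e n) hY x
  have hD1 := Dx_pos B₀ (BH1E e n) hY (x + 1)
  have hN := Nm_step B₀ Y x
  have hD := Dx_step B₀ (BH1E e n) hreg Y x
  rw [stepNumH1_eq, stepDenH1_eq e n Y x he hn] at hcert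
  have hc : 0 < ∏ j ∈ range 7, qsq Y (x + 1 + (BH1E e n j : ℝ)) := prod_pos fun _ _ => by unfold qsq; positivity
  have hq1 : 0 < qsq Y (x + (((34 * n : ℕ) : ℝ) + 2) / 2) * qsq Y (x + 1) := by unfold qsq; positivity
  have key : Nm B₀ Y x * Dx B₀ (BH1E e n) Y (x + 1) ≤ Nm B₀ Y (x + 1) * Dx B₀ (BH1E e n) Y x := by
    have hNm := Nm_pos B₀ hY x
    have := mul_le_mul_of_nonneg_left hcert (mul_pos hNm hD0).le
    have lhs : Nm B₀ Y x * Dx B₀ (BH1E e n) Y x *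
        (qsq Y (x + (((34 * n : ℕ) : ℝ) + 2) / 2) * qsq Y (x + 1) *
          ∏ j ∈ range 7, qsq Y (x + 1 + ((34 * n + 1 - BH1E e n j : ℕ) : ℝ))) =
        (Nm B₀ Y x * Dx B₀ (BH1E e n) Y (x + 1)) *
          ((qsq Y (x + (((34 * n : ℕ) : ℝ) + 2) / 2) * qsq Y (x + 1)) *
            ∏ j ∈ range 7, qsq Y (x + 1 + (BH1E e n j : ℝ))) := by
      rw [hB₀] at hD ⊢
      calc Nm (34 * n) Y x * Dx (34 * n) (BH1E e n) Y x *
            (qsq Y (x + (((34 * n : ℕ) : ℝ) + 2) / 2) * qsq Y (x + 1) *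
              ∏ j ∈ range 7, qsq Y (x + 1 + ((34 * n + 1 - BH1E e n j : ℕ) : ℝ)))
          = Nm (34 * n) Y x * (qsq Y (x + (((34 * n : ℕ) : ℝ) + 2) / 2) * qsq Y (x + 1)) *
              (Dx (34 * n) (BH1E e n) Y x *
                ∏ j ∈ range 7, qsq Y (x + 1 + ((34 * n + 1 - BH1E e n j : ℕ) : ℝ))) := by ring
        _ = Nm (34 * n) Y x * (qsq Y (x + (((34 * n : ℕ) : ℝ) + 2) / 2) * qsq Y (x + 1)) *
              (Dx (34 * n) (BH1E e n) Y (x + 1) * ∏ j ∈ range 7, qsq Y (x + 1 + (BH1E e n j : ℝ))) := by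
            rw [hD]
        _ = _ := by ring
    have rhs : Nm B₀ Y x * Dx B₀ (BH1E e n) Y x *
        (qsq Y (x + 1 + (((34 * n : ℕ) : ℝ) + 2) / 2) * qsq Y (x + 1 + ((34 * n + 1 : ℕ) : ℝ)) *
          ∏ j ∈ range 7, qsq Y (x + 1 + (BH1E e n j : ℝ))) =
        (Nm B₀ Y (x + 1) * Dx B₀ (BH1E e n) Y x) *
          ((qsq Y (x + (((34 * n : ℕ) : ℝ) + 2) / 2) * qsq Y (x + 1)) *
            ∏ j ∈ range 7, qsq Y (x + 1 + (BH1E e n j : ℝ))) := by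
      rw [hB₀] at hN ⊢
      push_cast at hN ⊢
      calc Nm (34 * n) Y x * Dx (34 * n) (BH1E e n) Y x *
            (qsq Y (x + 1 + ((34 : ℝ) * n + 2) / 2) * qsq Y (x + 1 + ((34 : ℝ) * n + 1)) *
              ∏ j ∈ range 7, qsq Y (x + 1 + (BH1E e n j : ℝ)))
          = (Nm (34 * n) Y x * (qsq Y (x + 1 + ((34 : ℝ) * n + 2) / 2) * qsq Y (x + 1 + ((34 : ℝ) * n + 1)))) *
              Dx (34 * n) (BH1E e n) Y x * ∏ j ∈ range 7, qsq Y (x + 1 + (BH1E e n j : ℝ)) := by ring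
        _ = (Nm (34 * n) Y (x + 1) * (qsq Y (x + ((34 : ℝ) * n + 2) / 2) * qsq Y (x + 1))) *
              Dx (34 * n) (BH1E e n) Y x * ∏ j ∈ range 7, qsq Y (x + 1 + (BH1E e n j : ℝ)) := by
            rw [hN]
        _ = _ := by ring
    rw [lhs, rhs] at this
    exact le_of_mul_le_mul_right this (mul_pos hq1 hc)
  have eq0 : ‖Rc (natB B₀ (BH1E e n)) ((x : ℂ) + Y * I)‖ ^ 2 = Nm B₀ Y x / Dx B₀ (BH1E e n) Y x := by
    rw [eq_div_iff hD0.ne']; exact h0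
  have eq1 : ‖Rc (natB B₀ (BH1E e n)) (((x + 1 : ℝ) : ℂ) + Y * I)‖ ^ 2 =
      Nm B₀ Y (x + 1) / Dx B₀ (BH1E e n) Y (x + 1) := by
    rw [eq_div_iff hD1.ne']; exact h1
  rw [eq0, eq1, div_le_div_iff₀ hD0 hD1]
  exact key

end Summit.KontsevichZagierPeriods.Zeta5Search.RayH1
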